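import Summits.BirchSwinnertonDyer.Rank1Residual.Additive.GoodModelKernelH1OfDeeplyRamified
import Summits.BirchSwinnertonDyer.Rank1Residual.Additive.PotSupersingularTprimeThreeNotCotorsion
import HarnessLib

/-!
# Greenberg LNM 1716 Thm. 1.7 (Schneider) on ALL of class O5 at every odd `p`, modulo the
# deeply-ramified trace fact A256 and (I1) (consumer twin of `ClassO5.not_isTorsion`, T-CG-SS,
# with the Coates–Greenberg record `hCG` = A254 fed by `H1_goodModelKernel_trivial_of_deeplyRamifiedTrace`)

HONEST FRAMING (BSD rank-`≤ 1` residual cell `b2b-bsdres`, home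
`run/shared/lean/b2b/bsd-rank1-residual/`, team n1011, seat n1011-p05 GEN 9, row T-CG-DR ADDENDUM
A2): the cell deletes the COMBINATION-SHAPED residual classes of the rank-`≤ 1` BSD formula from
PUBLISHED theorems only and TYPES the construction-shaped ones; research route, nothing booked, no
mark moves (O5 OPEN, RESIDUAL-MAP unchanged). Theorems only (one-liners, BY NAME): the T-CG-SS ENDs
`ClassO5.not_isTorsion_of_subGss / _of_subTprime / _of_subTprime_three / not_isTorsion` (Greenberg's
Thm. 1.7: on an O5 pair the Pontryagin dual of `Sel_{p^∞}(E/ℚ_∞)` is NOT `Λ`-torsion, a NEGATIVE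
structural theorem closing no pair) re-sourced from `hCG : H1_goodModelKernel_trivial` (A254) to
`hDR : deeplyRamified_cyclotomic_trace` (A256) through
`CoatesGreenberg1996.H1_goodModelKernel_trivial_of_deeplyRamifiedTrace`; `(I1)
relaxedSelmer_torsion_card_growth` carried verbatim. NOT a discharge of Tate–Sen or of (I1).

References: [GreenbergLNM1716] §1 Thm. 1.7, §2 pp. 83–84; [CoatesGreenberg1996] §2 p. 143, Thm.
2.13, §3 Cor. 3.2; [IovitaZaharescu1999] Thm. 1.2.
-/

noncomputable section

open scoped Classical NNReal

open WeierstrassCurve Literature.NumberTheory.EllipticCurves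
  Literature.NumberTheory.EllipticCurves.CoatesGreenberg1996 Literature.NumberTheory.GaloisRepresentations

namespace Summit.BirchSwinnertonDyer.Rank1Residual.Additive.GoodModelLine

open Literature.NumberTheory.EllipticCurves.Rank1Residual
  Literature.NumberTheory.EllipticCurves.Rank1Residual.Typed Field

variable (W : WeierstrassCurve ℚ) [W.IsElliptic] [W.IsGloballyMinimal] (p : ℕ) [hp : Fact p.Prime]

/-- **Greenberg Thm. 1.7 on ALL of O5 (every odd `p`) modulo A256 + (I1)**: for an O5 pair
`(E, p)` (additive, potentially good with supersingular-type residue classes `SubGss ∪ SubTprime`,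
see `ClassO5`), the dual Selmer datum `D` over the cyclotomic `ℤ_p`-extension is NOT `Λ`-torsion —
`ClassO5.not_isTorsion` with `hCG := H1_goodModelKernel_trivial_of_deeplyRamifiedTrace hDR`.
Negative structural theorem; closes no pair; O5 mark unchanged.
[cite: GreenbergLNM1716, §1 Thm. 1.7 and §2 pp. 83–84]
[cite: CoatesGreenberg1996, §2 p. 143 / Thm. 2.13 (through IovitaZaharescu1999 Thm. 1.2) and §3 Cor. 3.2] -/
theorem ClassO5.not_isTorsion_of_deeplyRamifiedTrace (hDR : deeplyRamified_cyclotomic_trace.{0})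
    (hI1 : relaxedSelmer_torsion_card_growth.{0}) (hO : ClassO5 W p)
    {κ : ZpExtension ℚ p} {γ : absoluteGaloisGroup ℚ} (D : SelmerDualData W κ γ)
    (hκ : κ.IsCyclotomic) (hγ : κ.IsTopGenerator γ) : ¬ D.IsTorsion :=
  ClassO5.not_isTorsion W p (H1_goodModelKernel_trivial_of_deeplyRamifiedTrace hDR) hI1 hO D hκ hγ

end Summit.BirchSwinnertonDyer.Rank1Residual.Additive.GoodModelLine

end
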